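import Mathlib
import HarnessLib
import Summits.NavierStokesRegularity.FluidComputer.TriggeredTransferH1
import Summits.NavierStokesRegularity.FluidComputer.TriggeredTransferDataZoom
import Summits.NavierStokesRegularity.FluidComputer.TriggeredTransferJunction

/-!
# Fluid computer, door N1-FC, DOOR v2 — module B: `H¹` through the zoom, the unforced junction from `H¹` data,
# and the hand-over regularity of a v2 link

Cell `ns-blowup`; drafted by the door's owner `ns-blowup-fc-route` (g3; RULING «door v2» of 2026-08-26, ns-blowup
STATUS l.3869, DRAFT `plan/route-draft-FC/door-v2/TriggeredTransferH1.DRAFT.lean` 839c72b3c3526d87, §3–§4) and filed by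
the prover seat `ns-blowup-fc-prover-2` (g5), with §5 added. Companion of `TriggeredTransferH1.lean` (module A: the
type `TriggerSchemeH1`, its predicates, the embedding `TriggerScheme.toH1`). LABEL: E–C typing hygiene / calculus.
WHAT THIS IS NOT: not Navier–Stokes evidence — two pieces of calculus (the `H¹` class passes through the zoom map;
Tao's unconditional uniqueness applied on an unforced window from `H¹` data) and their reading on the hand-over slice
of a v2 link taken as a HYPOTHESIS; no scheme instance, no transfer and no blow-up is asserted.

**Contents.** §3 `H¹` through the zoom (`hasFDerivAt_zoom`, `fderiv_zoom`, `lintegral_enorm_sq_fderiv_zoom`,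
`lintegral_enorm_sq_lt_top_of_memLp_two`, `memLp_two_zoom`, `memLp_two_fderiv_zoom`, `regular_zoom`);
§4 the unforced junction from `H¹` data
(`eq_on_unforced_window_H1`, of which v1's `eq_on_unforced_window` (`TriggeredTransferJunction.lean`) is the
rapidly-decaying special case — it stays the lemma of record for v1 and is not re-proved here);
§5 what the deferred port of the cascade chain feeds to the junction at every level: along a v2 link from a level `U ≥ U⋆`, the hand-over amplitude is again a level
(`Link.UStar_le_U'`), the hand-over slice `L.u L.T = zoom λ x₀ w'` is smooth, divergence free and `H¹`
(`Link.handover_eq_zoom`, `Link.handover_regular`, `Link.memLp_two_handover`, `Link.memLp_two_fderiv_handover`).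

References: T. Tao, Anal. PDE 6 (2013), Cor. 11.4 [cite: Tao2011, Cor. 11.4]; T. Tao, J. Amer. Math. Soc. 29 (2016)
601–674, §1.3 [cite: Tao2016AveragedNS, §1.3]; J. Leray, Acta Math. 63 (1934) §20 (similarity variables)
[cite: Leray1934, §20].

0 sorry; axioms ⊆ {propext, Classical.choice, Quot.sound}.
-/

noncomputable section

namespace Summit.NavierStokesRegularity.FluidComputer.TriggeredTransfer

open Set MeasureTheory Function Module
open scoped ENNReal ContDiff NNReal
open Literature.Analysis.FluidPDE
open Literature.Analysis.FluidPDE.FluidComputer (E3 Vel)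
open Summit.NavierStokesRegularity.NavierStokesRegularity.Theorems

/-! ## §3 `H¹` through the zoom -/

/-- The derivative of a zoomed field: `D(zoom c x₀ w)(x) = c² • Dw(c • (x - x₀))`. [folklore] -/
theorem hasFDerivAt_zoom {w : Vel} (hw : Differentiable ℝ w) (c : ℝ) (x₀ x : E3) :
    HasFDerivAt (zoom c x₀ w) ((c * c) • fderiv ℝ w (c • (x - x₀))) x := by
  have hA : HasFDerivAt (fun y : E3 => c • (y - x₀)) (c • ContinuousLinearMap.id ℝ E3) x :=
    ((hasFDerivAt_id x).sub_const x₀).const_smul c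
  have hB : HasFDerivAt (fun y : E3 => w (c • (y - x₀)))
      ((fderiv ℝ w (c • (x - x₀))).comp (c • ContinuousLinearMap.id ℝ E3)) x :=
    (hw (c • (x - x₀))).hasFDerivAt.comp x hA
  have hC : HasFDerivAt (fun y : E3 => c • w (c • (y - x₀)))
      (c • (fderiv ℝ w (c • (x - x₀))).comp (c • ContinuousLinearMap.id ℝ E3)) x :=
    hB.const_smul c
  have hEq : c • (fderiv ℝ w (c • (x - x₀))).comp (c • ContinuousLinearMap.id ℝ E3) =
      (c * c) • fderiv ℝ w (c • (x - x₀)) := by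
    ext v
    simp [smul_smul]
  rw [hEq] at hC
  exact hC

/-- `fderiv` of a zoomed field. [folklore] -/
theorem fderiv_zoom {w : Vel} (hw : Differentiable ℝ w) (c : ℝ) (x₀ x : E3) :
    fderiv ℝ (zoom c x₀ w) x = (c * c) • fderiv ℝ w (c • (x - x₀)) :=
  (hasFDerivAt_zoom hw c x₀ x).fderiv

/-- Enstrophy of a zoomed state: `∫⁻ ‖D(zoom c x₀ w)‖ₑ² = (c²)² · (c³)⁻¹ · ∫⁻ ‖Dw‖ₑ²` (`c > 0`; the
factor is `c`). [folklore] -/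
theorem lintegral_enorm_sq_fderiv_zoom {w : Vel} (hw : Differentiable ℝ w) {c : ℝ} (hc : 0 < c)
    (x₀ : E3) :
    ∫⁻ x, ‖fderiv ℝ (zoom c x₀ w) x‖ₑ ^ 2 =
      ENNReal.ofReal ((c * c) ^ 2) * ENNReal.ofReal (c ^ 3)⁻¹ * ∫⁻ x, ‖fderiv ℝ w x‖ₑ ^ 2 := by
  have hcc : 0 ≤ c * c := (mul_pos hc hc).le
  have h1 : ∀ x, ‖fderiv ℝ (zoom c x₀ w) x‖ₑ ^ 2 =
      ENNReal.ofReal ((c * c) ^ 2) * (fun y => ‖fderiv ℝ w y‖ₑ ^ 2) (-(c • x₀) + c • x) := by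
    intro x
    rw [fderiv_zoom hw, smul_sub, sub_eq_neg_add, enorm_smul, mul_pow, Real.enorm_eq_ofReal hcc,
      ENNReal.ofReal_pow hcc]
  simp_rw [h1]
  rw [lintegral_const_mul' _ _ ENNReal.ofReal_ne_top,
    lintegral_comp_space_affine hc (-(c • x₀)) (fun y => ‖fderiv ℝ w y‖ₑ ^ 2),
    finrank_euclideanSpace_fin, mul_assoc]

/-- From `MemLp f 2` to a finite `∫⁻ ‖f‖ₑ²` (the converse spelling,
`Literature.Analysis.FluidPDE.memLp_two_of_lintegral_sq_finite`, is inlined below where used). [folklore] -/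
theorem lintegral_enorm_sq_lt_top_of_memLp_two {X : Type*} [MeasurableSpace X] {μ : Measure X}
    {G : Type*} [NormedAddCommGroup G] {f : X → G} (h : MemLp f 2 μ) :
    ∫⁻ x, ‖f x‖ₑ ^ 2 ∂μ < ⊤ := by
  have := lintegral_rpow_enorm_lt_top_of_eLpNorm_lt_top two_ne_zero ENNReal.ofNat_ne_top
    h.eLpNorm_lt_top
  simpa [ENNReal.toReal_ofNat] using this

/-- **`L²` through the zoom** (`c > 0`). [folklore] -/
theorem memLp_two_zoom {w : Vel} (hwc : Continuous w) (hw : MemLp w 2 volume) {c : ℝ} (hc : 0 < c)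
    (x₀ : E3) : MemLp (zoom c x₀ w) 2 volume := by
  have hcont : Continuous (zoom c x₀ w) :=
    (hwc.comp ((continuous_id.sub continuous_const).const_smul c)).const_smul c
  have h : ∫⁻ x, ‖zoom c x₀ w x‖ₑ ^ 2 < ⊤ := by
    rw [lintegral_enorm_sq_zoom hc x₀ w]
    exact ENNReal.mul_lt_top (ENNReal.mul_lt_top ENNReal.ofReal_lt_top ENNReal.ofReal_lt_top)
      (lintegral_enorm_sq_lt_top_of_memLp_two hw)
  -- `MemLp f 2` from a finite `∫⁻ ‖f‖ₑ²` (cf. `Literature.Analysis.FluidPDE.memLp_two_of_lintegral_sq_finite`)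
  refine ⟨hcont.aestronglyMeasurable, ?_⟩
  rw [eLpNorm_lt_top_iff_lintegral_rpow_enorm_lt_top two_ne_zero ENNReal.ofNat_ne_top]
  simpa [ENNReal.toReal_ofNat] using h

/-- **`∇ ∈ L²` through the zoom** (`c > 0`, `w ∈ C¹`). [folklore] -/
theorem memLp_two_fderiv_zoom {w : Vel} (hw1 : ContDiff ℝ 1 w) (hw : MemLp (fderiv ℝ w) 2 volume)
    {c : ℝ} (hc : 0 < c) (x₀ : E3) : MemLp (fderiv ℝ (zoom c x₀ w)) 2 volume := by
  have hcont : Continuous (fderiv ℝ (zoom c x₀ w)) :=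
    (contDiff_zoom hw1 c x₀).continuous_fderiv one_ne_zero
  have h : ∫⁻ x, ‖fderiv ℝ (zoom c x₀ w) x‖ₑ ^ 2 < ⊤ := by
    rw [lintegral_enorm_sq_fderiv_zoom (hw1.differentiable one_ne_zero) hc x₀]
    exact ENNReal.mul_lt_top (ENNReal.mul_lt_top ENNReal.ofReal_lt_top ENNReal.ofReal_lt_top)
      (lintegral_enorm_sq_lt_top_of_memLp_two hw)
  refine ⟨hcont.aestronglyMeasurable, ?_⟩
  rw [eLpNorm_lt_top_iff_lintegral_rpow_enorm_lt_top two_ne_zero ENNReal.ofNat_ne_top]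
  simpa [ENNReal.toReal_ofNat] using h

/-- **The v2 clauses pass through the zoom** (`c > 0`): smooth, divergence free, `H¹` — so the
junction datum `u T = zoom λ x₀ w'` of a v2 step is in Tao's uniqueness class whenever `w'` is a v2
member. [folklore] -/
theorem regular_zoom {w : Vel}
    (h : ContDiff ℝ ∞ w ∧ NSWave0.IsDivFree w ∧ MemLp w 2 volume ∧ MemLp (fderiv ℝ w) 2 volume)
    {c : ℝ} (hc : 0 < c) (x₀ : E3) :
    ContDiff ℝ ∞ (zoom c x₀ w) ∧ NSWave0.IsDivFree (zoom c x₀ w) ∧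
      MemLp (zoom c x₀ w) 2 volume ∧ MemLp (fderiv ℝ (zoom c x₀ w)) 2 volume :=
  ⟨contDiff_zoom h.1 c x₀, isDivFree_zoom (h.1.differentiable (by simp)) h.2.1 c x₀,
    memLp_two_zoom h.1.continuous h.2.2.1 hc x₀,
    memLp_two_fderiv_zoom (h.1.of_le (by norm_cast)) h.2.2.2 hc x₀⟩

/-! ## §4 The unforced junction from `H¹` data -/

/-- **THE UNFORCED JUNCTION, `H¹` form.** Let `ν > 0`, `t₁ < t₂`, and let `(u₁, p₁)`, `(u₂, p₂)` be
classical solutions on `[t₁, t₂]` whose forces VANISH on the window, with finite energy there,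
sharing the slice `u₁ t₁ = u₂ t₁ ∈ H¹` (`L²` with `L²` gradient). Then `u₁ = u₂` on `[t₁, t₂]` —
Tao's unconditional uniqueness, unforced velocity form, a THEOREM of the tree
(`tao_unconditional_uniqueness_velocity_holds`), after a time shift. v1's `eq_on_unforced_window` is
the special case of a rapidly decaying slice (`ClayUniqueness.memLp_two_of_rapidDecay`). This is all
a cascade junction consumes of the alphabet. [cite: Tao2011, Cor. 11.4] -/
theorem eq_on_unforced_window_H1 {ν t₁ t₂ : ℝ} (hν : 0 < ν) (ht : t₁ < t₂)
    {f₁ f₂ u₁ u₂ : ℝ → Vel} {p₁ p₂ : ℝ → E3 → ℝ}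
    (h₁ : IsClassicalNSSolutionOn (Icc t₁ t₂) ν f₁ u₁ p₁)
    (h₂ : IsClassicalNSSolutionOn (Icc t₁ t₂) ν f₂ u₂ p₂)
    (hf₁ : ∀ t ∈ Icc t₁ t₂, f₁ t = 0) (hf₂ : ∀ t ∈ Icc t₁ t₂, f₂ t = 0)
    (h0 : u₁ t₁ = u₂ t₁)
    (hL2 : MemLp (u₁ t₁) 2 volume) (hH1 : MemLp (fderiv ℝ (u₁ t₁)) 2 volume)
    (hE₁ : ∃ C : ℝ≥0∞, C < ⊤ ∧ ∀ t ∈ Icc t₁ t₂, ∫⁻ x, ‖u₁ t x‖ₑ ^ 2 ≤ C)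
    (hE₂ : ∃ C : ℝ≥0∞, C < ⊤ ∧ ∀ t ∈ Icc t₁ t₂, ∫⁻ x, ‖u₂ t x‖ₑ ^ 2 ≤ C) :
    ∀ t ∈ Icc t₁ t₂, u₁ t = u₂ t := by
  have hT : 0 < t₂ - t₁ := sub_pos.2 ht
  have hs₁ : IsClassicalNSSolutionOn (Icc 0 (t₂ - t₁)) ν 0 (fun t => u₁ (t + t₁))
      (fun t => p₁ (t + t₁)) :=
    isClassicalNSSolutionOn_force_congr (isClassicalNSSolutionOn_shift_Icc h₁ ht)
      fun s hs => hf₁ (s + t₁) ⟨by linarith [hs.1], by linarith [hs.2]⟩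
  have hs₂ : IsClassicalNSSolutionOn (Icc 0 (t₂ - t₁)) ν 0 (fun t => u₂ (t + t₁))
      (fun t => p₂ (t + t₁)) :=
    isClassicalNSSolutionOn_force_congr (isClassicalNSSolutionOn_shift_Icc h₂ ht)
      fun s hs => hf₂ (s + t₁) ⟨by linarith [hs.1], by linarith [hs.2]⟩
  have hE₁' : ∃ C : ℝ≥0∞, C < ⊤ ∧ ∀ s ∈ Icc 0 (t₂ - t₁), ∫⁻ x, ‖u₁ (s + t₁) x‖ₑ ^ 2 ≤ C := by
    obtain ⟨C, hC, hb⟩ := hE₁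
    exact ⟨C, hC, fun s hs => hb (s + t₁) ⟨by linarith [hs.1], by linarith [hs.2]⟩⟩
  have hE₂' : ∃ C : ℝ≥0∞, C < ⊤ ∧ ∀ s ∈ Icc 0 (t₂ - t₁), ∫⁻ x, ‖u₂ (s + t₁) x‖ₑ ^ 2 ≤ C := by
    obtain ⟨C, hC, hb⟩ := hE₂
    exact ⟨C, hC, fun s hs => hb (s + t₁) ⟨by linarith [hs.1], by linarith [hs.2]⟩⟩
  have key := tao_unconditional_uniqueness_velocity_holds ν (t₂ - t₁) hν hT (u₁ t₁) hL2 hH1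
    (fun t => u₁ (t + t₁)) (fun t => u₂ (t + t₁)) (fun t => p₁ (t + t₁)) (fun t => p₂ (t + t₁))
    hs₁ hs₂ (by simp) (by simp [h0]) hE₁' hE₂'
  intro t htI
  have := key (t - t₁) ⟨by linarith [htI.1], by linarith [htI.2]⟩
  simpa using this

/-! ## §5 The hand-over slice of a v2 link is in the junction's data class -/

namespace TriggerSchemeH1

variable {𝒮 : TriggerSchemeH1}

/-- Along a link from a level `U ≥ U⋆` the hand-over amplitude is again a level: `U⋆ ≤ U ≤ growth · U ≤ U'`
(`growth > 1`, `U⋆ > 0`). [folklore] -/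
theorem Link.UStar_le_U' {ν U ε : ℝ} {w : Vel} (L : 𝒮.Link ν U ε w) (hU : 𝒮.UStar ≤ U) : 𝒮.UStar ≤ L.U' := by
  have hU0 : 0 ≤ U := 𝒮.UStar_pos.le.trans hU
  calc 𝒮.UStar ≤ U := hU
    _ = 1 * U := (one_mul U).symm
    _ ≤ 𝒮.growth * U := mul_le_mul_of_nonneg_right 𝒮.one_lt_growth.le hU0
    _ ≤ L.U' := L.growth_le

/-- The hand-over slice of a link IS the zoomed member: `L.u L.T = zoom λ x₀ w'` (the hand-over clause, read through
`zoom`). [folklore] -/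
theorem Link.handover_eq_zoom {ν U ε : ℝ} {w : Vel} (L : 𝒮.Link ν U ε w) :
    L.u L.T = zoom 𝒮.lam L.x₀ L.w' :=
  L.handover

/-- **The hand-over slice of a v2 link from a level `U ≥ U⋆` is smooth, divergence free and `H¹`** — the member
`w' ∈ F U'` is (`regular`, `U' ≥ U⋆` by `Link.UStar_le_U'`) and the three clauses pass through the zoom
(`regular_zoom`, `λ > 0`). This is the datum the junction `eq_on_unforced_window_H1` consumes at every level of a
cascade over the v2 door. [folklore] -/
theorem Link.handover_regular {ν U ε : ℝ} {w : Vel} (L : 𝒮.Link ν U ε w) (hU : 𝒮.UStar ≤ U) :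
    ContDiff ℝ ∞ (L.u L.T) ∧ NSWave0.IsDivFree (L.u L.T) ∧
      MemLp (L.u L.T) 2 volume ∧ MemLp (fderiv ℝ (L.u L.T)) 2 volume := by
  rw [L.handover_eq_zoom]
  exact regular_zoom (𝒮.regular L.U' (L.UStar_le_U' hU) L.w' L.mem) 𝒮.lam_pos L.x₀

/-- The hand-over slice of a v2 link from a level is in `L²`. [folklore] -/
theorem Link.memLp_two_handover {ν U ε : ℝ} {w : Vel} (L : 𝒮.Link ν U ε w) (hU : 𝒮.UStar ≤ U) :
    MemLp (L.u L.T) 2 volume :=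
  (L.handover_regular hU).2.2.1

/-- The hand-over slice of a v2 link from a level has gradient in `L²`. [folklore] -/
theorem Link.memLp_two_fderiv_handover {ν U ε : ℝ} {w : Vel} (L : 𝒮.Link ν U ε w) (hU : 𝒮.UStar ≤ U) :
    MemLp (fderiv ℝ (L.u L.T)) 2 volume :=
  (L.handover_regular hU).2.2.2

end TriggerSchemeH1

end Summit.NavierStokesRegularity.FluidComputer.TriggeredTransfer

end
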